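import Mathlib
import Summits.NavierStokesRegularity.NavierStokesRegularity.Theorems.TaoLadderRungTwoFlatNearBehindStepIface
import HarnessLib

/-!
# The near/behind step with the interface loop of record for a GENERIC SLOT (the split tube of CoreContractZ, TRAP #24 cure P-64a)
  (helper for the K_A♭ parent item stmt-NavierStokesRegularity-22987 `FlatGapCertificatesV2`, child 2A `GradedAdiabaticWakeA` of route
  TaoLadderRungTwoFlat; cell harvest/h2-tao-ladder, p1 g24; LADDER §61, §64)

`…NearBehindStepIface` (p718384) states P-61a for the slot `behindR54 P θ′ Wb` literally. theory-1 g49's TRAP #24 cure (CoreContractZ64,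
landed as `…CoreContractZ`) runs the induction on the RE-INSTANCED tube `InTubeWith (wakeSchedule P aK) (splitBcl …)` whose slot is
`behindR54 … ∧ CoreClauseFrom …` — a STRONGER slot, so hypotheses quantified over its premises are weaker and the landed theorem cannot be
instantiated from them. This module re-runs the same proofs for ANY slot `Bcl` with `Bcl n z → behindR54 P θ′ Wb n z`, and states the
conclusion at good times (the form the split composition consumes):

* `interfaceLevels_of_schedule_slot` — interface levels on `[0, t]` at good times (the `hlev` of `CoreLandingFromZ` and of `wakeRow_of_levels`);
* `nearBehindR54_landing_of_schedule_slot` — `NearClause (n+1)` and `behindR54 (n+1)` ((B1) + (B2∃)) of the re-centred state at every good time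
  (⇒ `TubeStepNearWith` by `tubeStepNearWith_of_good`; ⇒ the `HB` input of `tubeStepBehindWith_split`).

HONEST FRAMING: bookkeeping over the cell's typed induction frame and p1's zone lemmas (MODEL lattice, graded mirror table on `S♭`,
`m = 2`); the reference family, the deeper core input `ρ₂`, the template landing residual and every scalar schedule inequality are
HYPOTHESES; nothing certified; no item closed; nothing about the Navier–Stokes equations.
-/

noncomputable section

-- the sub-problem namespace repeats the summit name by design (D-0017)
set_option linter.dupNamespace false

namespace Summit.NavierStokesRegularity.NavierStokesRegularity.Theorems.HopTube

open Set Finset Literature.Analysis.FluidPDE Literature.Analysis.FluidPDE.TaoCascade MirrorPulse GappedFrontRobustOn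

section Slot

variable {ε ε₀ : ℝ}

set_option maxHeartbeats 400000 in
/-- **THE INTERFACE LEVELS AT GOOD TIMES, generic slot** (P-61a; the `hlev` input of `CoreLandingFromZ` / `wakeRow_of_levels` for the
split tube of CoreContractZ): as `interfaceLevels_of_schedule_iface`, for any slot `Bcl` implying the R54 behind clause.
ORIGINAL: along every premise of hop `n > N₀` of
the R54 tube and at every good time `t` in the clock window, the interface deviations `|(S−W)₀(1−K, s)| ≤ RBAR`,
`|(S−W)₁(1−K, s)| ≤ BBAR` for all `s ∈ [0, t]`, from the schedule hypotheses (starts from `H(n)`, interface levels L-61a/L-61b,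
near/behind rates and levels in window form) and the deeper core input `ρ₂`.
[cite: Tao2016AveragedNS, §4 (4.1), (4.3), (4.8), §5, §6.3–6.4 (statement shape); route TaoLadderRungTwoFlat, interface loop of record (cell LADDER §61, referee W-27)] -/
theorem interfaceLevels_of_schedule_slot (P : TubeSchedule) {θ' : ℝ} {Wb : ℕ → ℝ} {i₀ : Fin 2}
    {Bcl : ℕ → (Fin 2 → ℤ → ℝ) → Prop} (hBcl : ∀ m z, Bcl m z → behindR54 P θ' Wb m z)
    {X₀ : Fin 2 → ℝ} {w : ℤ → ℝ} {r c₀ : ℝ} {ζ : ℕ → Fin 2 → ℤ → ℝ} {ustar : Fin 2 → ℤ → ℝ}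
    {good : ℕ → (Fin 2 → ℤ → ℝ → ℝ) → ℝ → Prop} {n : ℕ}
    {cW κ₂ : ℝ} {W₀ FW₀ BW₀ : (Fin 2 → ℤ → ℝ) → Fin 2 → ℤ → ℝ} {W FW : (Fin 2 → ℤ → ℝ) → Fin 2 → ℤ → ℝ → ℝ}
    (hWflow : ∀ z, InTubeWith P Bcl i₀ X₀ w r ζ ustar n z →
      PseudoFlowOnShift shiftSetFlat cW ε₀ (mirrorTable ε ε) 0 κ₂ (W₀ z) (FW₀ z) (BW₀ z) (W z) (FW z)) (hcW : c₀ ≤ cW)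
    (hε : 0 ≤ ε) (hε₀ : 0 < ε₀) (hn : P.N₀ < n) (hK : 1 ≤ P.K) (hDK : P.K + 1 ≤ P.D) (hθV : 0 < P.θV)
    (hθ : 0 < θ') (hθ5 : θ' ≤ 5 * Real.log (1 + ε₀)) (hw1 : ∀ k, 1 ≤ w k) (hr0 : 0 ≤ r)
    (hAstar : 0 < P.Astar) {ωK MuK : ℝ} (hωK : 0 < ωK)
    (hωKle : ∀ i, ωK ≤ MirrorPulse.geomGauge P.g P.b i (-(P.K : ℤ))) (hMuK : ∀ i, |ustar i (-(P.K : ℤ))| ≤ MuK)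
    (hWbn : 0 ≤ Wb n)
    (hwin : ∀ z S₀ τ S F, HopPremiseWith P Bcl shiftSetFlat ε₀ i₀ (mirrorTable ε ε) X₀ w r c₀ ζ
      ustar n z S₀ τ S F → ∀ t, good n S t → 0 < t ∧ t ≤ c₀)
    {Aeff A A₀ A₁ M M₁ M₂ rI RBAR BBAR RHO2 rs I₁ I₂ PUMP μN μB VbarN VbarB EW V₀N V₀B EN : ℝ}
    (hAeff : 0 < Aeff) (hM0 : 0 ≤ M)
    (hM : ∀ z, InTubeWith P Bcl i₀ X₀ w r ζ ustar n z →
      ∀ s ∈ Icc 0 c₀, ∀ i, ∀ m ∈ Finset.Icc (-(P.D : ℤ)) (1 - (P.K : ℤ)), |W z i m s| ≤ M)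
    (hM₁ : ∀ z, InTubeWith P Bcl i₀ X₀ w r ζ ustar n z → ∀ s ∈ Icc 0 c₀, |W z 1 (-(P.K : ℤ)) s| ≤ M₁)
    (hM₂0 : 0 ≤ M₂)
    (hM₂ : ∀ z, InTubeWith P Bcl i₀ X₀ w r ζ ustar n z → ∀ s ∈ Icc 0 c₀, |W z 0 (2 - (P.K : ℤ)) s| ≤ M₂)
    (hEW : ∀ z, InTubeWith P Bcl i₀ X₀ w r ζ ustar n z →
      coMovingEnergyOn (Finset.Icc (1 - (P.D : ℤ)) (-(P.K : ℤ))) P.θV (-(P.K : ℝ))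
        (fun i k _ => anchorScale P i₀ z * ustar i k - W₀ z i k) 0 ≤ EW)
    -- section datum at the interface shell and the deeper core input
    (hsec : ∀ z S₀ τ S F, HopPremiseWith P Bcl shiftSetFlat ε₀ i₀ (mirrorTable ε ε) X₀ w r c₀ ζ
      ustar n z S₀ τ S F → ∀ i, |(S - W z) i (1 - (P.K : ℤ)) 0| ≤ rs)
    (hρ0 : 0 ≤ RHO2)
    (hcore2 : ∀ z S₀ τ S F, HopPremiseWith P Bcl shiftSetFlat ε₀ i₀ (mirrorTable ε ε) X₀ w r c₀ ζ
      ustar n z S₀ τ S F → ∀ t, good n S t → ∀ s ∈ Icc 0 t, |(S - W z) 0 (2 - (P.K : ℤ)) s| ≤ RHO2)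
    -- interface levels (L-61a/L-61b) and link facts
    (hRB0 : 0 ≤ RBAR) (hBB0 : 0 ≤ BBAR) (hRr : RBAR ≤ rI) (hBr : BBAR ≤ rI) (hVN0 : 0 ≤ VbarN)
    (hI₁0 : 0 ≤ I₁) (hI₂0 : 0 ≤ I₂)
    (hI₁ : 2 * (Real.exp (P.θV / 2) - 1) ≤ I₁ * P.θV) (hI₂ : Real.exp P.θV - 1 ≤ I₂ * P.θV)
    (hPUMPdef : PUMP = 1 * c₀ * ((2 + ε) * M * I₁ * Real.sqrt (2 * VbarN) + 2 * I₂ * VbarN))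
    (hlevC : rs + PUMP + 1 * c₀ * ((ε * (M + I₁ * Real.sqrt (2 * VbarN)) + ε * M + ε * BBAR) * RBAR
      + (2 + ε) * M * BBAR + BBAR ^ 2) < RBAR)
    (hlevV : rs + 1 * c₀ * ((M + M₂ + RBAR + RHO2) * BBAR + (1 + 2 * ε) * M * RBAR + ε * RBAR ^ 2
      + (M + 2 * ε * M₂) * RHO2 + ε * RHO2 ^ 2) < BBAR)
    -- near/behind schedule (window forms)
    (hAdef : A = Real.sqrt (2 * VbarB) * Real.exp (θ' / 2) * Real.exp (θ' * ((P.D : ℝ) - P.K) / 2) + M)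
    (hA₀def : A₀ = M + rI) (hA₁def : A₁ = M₁ + Real.sqrt (2 * VbarN) * Real.exp (P.θV / 2))
    (hrA : rI ≤ A) (hA₀le : A₀ ≤ Aeff)
    (hV₀Ndef : V₀N = (Real.sqrt (P.v n + (P.δ n / ωK) ^ 2) + Real.sqrt P.D * r + Real.sqrt EW) ^ 2)
    (hV₀Bdef : V₀B = (Real.sqrt (Wb n + (MuK + P.δ n / ωK) ^ 2) + r / Real.sqrt (1 - Real.exp (-θ'))) ^ 2)
    (hENdef : EN = Real.exp (P.θV * ((1 : ℝ) - P.D + P.K)) * ((1 + ε) * 1 * A ^ 2 * (A + M))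
      + 1 * rI * (2 * VbarN + ε * rI * Real.sqrt (2 * VbarN) + (1 + ε) * M * rI))
    (hμN : 0 < μN)
    (hμNle : μN ≤ (1 / c₀) * P.θV - 2 * (1 + ε) * 1 * (A * Real.sinh (P.θV / 2) + M * (3 + Real.exp P.θV)))
    (hμB : 0 < μB) (hμBle : μB ≤ (1 / c₀) * θ' - 2 * (1 + ε) * Aeff * Real.sinh (θ' / 2))
    (hlevN : V₀N + EN * c₀ < VbarN) (hlevB : V₀B + A₁ * A₀ * (A₁ + ε * A₀) * c₀ < VbarB)
    (hclose : Real.sqrt (2 * VbarB) * Real.exp (θ' / 2) ≤ Aeff) :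
    ∀ z S₀ τ S F, HopPremiseWith P Bcl shiftSetFlat ε₀ i₀ (mirrorTable ε ε) X₀ w r c₀ ζ
      ustar n z S₀ τ S F → ∀ t, good n S t →
        ∀ s ∈ Icc 0 t, |(S - W z) 0 (1 - (P.K : ℤ)) s| ≤ RBAR ∧ |(S - W z) 1 (1 - (P.K : ℤ)) s| ≤ BBAR := by
  intro z S₀ τf S F hprem t hgood
  obtain ⟨htpos, htc₀⟩ := hwin z S₀ τf S F hprem t hgood
  have hsec_t := hsec z S₀ τf S F hprem
  have hcore_t := hcore2 z S₀ τf S F hprem t hgood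
  obtain ⟨hz, hkick, hc₀τ, hflow⟩ := hprem
  -- the clauses of `H(n)` (tube phase)
  have hzW : InTubeWith P Bcl i₀ X₀ w r ζ ustar n z := hz
  have h0 : n ≠ 0 := by omega
  have h1 : ¬ n ≤ P.N₀ := by omega
  simp only [InTubeWith, h0, if_false, h1] at hz
  obtain ⟨hanch, hcoreCl, hnearCl, hbeh', -⟩ := hz
  have hbeh := hBcl n z hbeh'
  -- the reference flow of this premise (co-scaled family, TRAP #25 cure (α))
  have hWz := hWflow z hzW
  -- restrict both flows to `[0, t]`
  have hS' := pseudoFlowOnShift_mono hflow htpos (htc₀.trans hc₀τ)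
  have hW' := pseudoFlowOnShift_mono hWz htpos (htc₀.trans hcW)
  -- the kick, everywhere (weights `≥ 1`)
  have hkick' : ∀ i k, |S₀ i k - z i k| ≤ r := by
    intro i k
    calc |S₀ i k - z i k| = 1 * |S₀ i k - z i k| := (one_mul _).symm
      _ ≤ w k * |S₀ i k - z i k| := mul_le_mul_of_nonneg_right (hw1 k) (abs_nonneg _)
      _ ≤ r := hkick i k
  -- the STARTS from `H(n)`
  have hstartN : coMovingEnergyOn (Finset.Icc (1 - (P.D : ℤ)) (-(P.K : ℤ))) P.θV (-(P.K : ℝ)) (S - W z) 0 ≤ V₀N := by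
    have h := sqrt_initial_coMovingEnergyOn_le_additive P hflow.init_S hWz.init_S hθV.le hDK hnearCl hcoreCl hωK hωKle
      (fun i k _ => hkick' i k) hr0 (hEW z hzW)
    have hnn : 0 ≤ coMovingEnergyOn (Finset.Icc (1 - (P.D : ℤ)) (-(P.K : ℤ))) P.θV (-(P.K : ℝ)) (S - W z) 0 :=
      coMovingEnergyOn_nonneg _ _ _ _ _
    rw [hV₀Ndef]
    calc coMovingEnergyOn (Finset.Icc (1 - (P.D : ℤ)) (-(P.K : ℤ))) P.θV (-(P.K : ℝ)) (S - W z) 0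
        = Real.sqrt (coMovingEnergyOn (Finset.Icc (1 - (P.D : ℤ)) (-(P.K : ℤ))) P.θV (-(P.K : ℝ)) (S - W z) 0) ^ 2 :=
          (Real.sq_sqrt hnn).symm
      _ ≤ _ := pow_le_pow_left₀ (Real.sqrt_nonneg _) h 2
  have haK : ∀ i, |z i (-(P.K : ℤ))| ≤ MuK + P.δ n / ωK := fun i =>
    abs_windowBottom_le_of_clauses P hAstar hanch hcoreCl hωK hωKle hMuK i
  have hstartB : ∀ L : ℕ, coMovingEnergyOn (Finset.Icc (1 - (P.K : ℤ) - L) (-(P.K : ℤ))) θ' (-(P.K : ℝ)) S 0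
      ≤ V₀B := by
    intro L
    rw [hV₀Bdef]
    exact R54.initial_blockEnergy_le_additive hflow.init_S hθ hbeh.1 hWbn haK (fun i k hk => hkick' i k) hr0
  -- the interface loop on `[0, t]`
  rw [hENdef] at hlevN
  exact R54.interface_apriori_of_pseudoFlows hW' hS' hε hε₀ hK hDK hθV hθ.le hθ5 hAeff htpos le_rfl htc₀ hM0
    (fun s hs => hM z hzW s ⟨hs.1, hs.2.trans htc₀⟩) (fun s hs => hM₁ z hzW s ⟨hs.1, hs.2.trans htc₀⟩) hM₂0
    (fun s hs => hM₂ z hzW s ⟨hs.1, hs.2.trans htc₀⟩) hsec_t hρ0 hcore_t hRB0 hBB0 hRr hBr hVN0 hI₁0 hI₂0 hI₁ hI₂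
    hPUMPdef hlevC hlevV hAdef hA₀def hA₁def hrA hA₀le hstartN hstartB hμN hμNle hμB hμBle hlevN hlevB hclose

set_option maxHeartbeats 400000 in
/-- **THE NEAR AND BEHIND LANDING CLAUSES AT GOOD TIMES, generic slot** (P-61a with the interface loop of record, co-scaled
reference family): for every premise of hop `n > N₀` from a tube whose slot `Bcl` implies the R54 behind clause, and every good time
`t`, the re-centred state at the clamped ratio satisfies `NearClause (n+1)` and `behindR54 (n+1)` ((B1) energy clause + (B2∃) cap).
This is the `key` of `tubeStepNearBehindR54_of_schedule_iface` exposed for the split tube of CoreContractZ (`tubeStepNearWith_of_good`,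
`tubeStepBehindWith_split`). Hypotheses as there (literal shapes in `…NearBehindStepIface`).
[cite: Tao2016AveragedNS, §4 (4.1), (4.3), (4.5), (4.8), §6.3–6.4 Props. 6.4–6.5 (statement shape of the inductive step); route TaoLadderRungTwoFlat, `HopTube.TubeStepNearWith`/`TubeStepBehindWith` for `behindR54` with the interface loop (cell LADDER §50, §54–§61, referee W-27)] -/
theorem nearBehindR54_landing_of_schedule_slot (P : TubeSchedule) {θ' : ℝ} {Wb : ℕ → ℝ} {i₀ : Fin 2}
    {Bcl : ℕ → (Fin 2 → ℤ → ℝ) → Prop} (hBcl : ∀ m z, Bcl m z → behindR54 P θ' Wb m z)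
    {X₀ : Fin 2 → ℝ} {w : ℤ → ℝ} {r θ₀ c₀ : ℝ} {ζ : ℕ → Fin 2 → ℤ → ℝ} {ustar : Fin 2 → ℤ → ℝ}
    {good : ℕ → (Fin 2 → ℤ → ℝ → ℝ) → ℝ → Prop} {n : ℕ}
    {cW κ₂ : ℝ} {W₀ FW₀ BW₀ : (Fin 2 → ℤ → ℝ) → Fin 2 → ℤ → ℝ} {W FW : (Fin 2 → ℤ → ℝ) → Fin 2 → ℤ → ℝ → ℝ}
    (hWflow : ∀ z, InTubeWith P Bcl i₀ X₀ w r ζ ustar n z →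
      PseudoFlowOnShift shiftSetFlat cW ε₀ (mirrorTable ε ε) 0 κ₂ (W₀ z) (FW₀ z) (BW₀ z) (W z) (FW z)) (hcW : c₀ ≤ cW)
    (hε : 0 ≤ ε) (hε₀ : 0 < ε₀) (hn : P.N₀ < n) (hK : 1 ≤ P.K) (hDK : P.K + 1 ≤ P.D) (hθV : 0 < P.θV)
    (hθ : 0 < θ') (hθ5 : θ' ≤ 5 * Real.log (1 + ε₀)) (hw1 : ∀ k, 1 ≤ w k) (hr0 : 0 ≤ r)
    (hAstar : 0 < P.Astar) {ωK MuK : ℝ} (hωK : 0 < ωK)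
    (hωKle : ∀ i, ωK ≤ MirrorPulse.geomGauge P.g P.b i (-(P.K : ℤ))) (hMuK : ∀ i, |ustar i (-(P.K : ℤ))| ≤ MuK)
    (hWbn : 0 ≤ Wb n) (hWbn1 : 0 ≤ Wb (n + 1)) (hvn1 : 0 ≤ P.v (n + 1))
    {tlo : ℝ} (htlo : 0 < tlo)
    (hwin : ∀ z S₀ τ S F, HopPremiseWith P Bcl shiftSetFlat ε₀ i₀ (mirrorTable ε ε) X₀ w r c₀ ζ
      ustar n z S₀ τ S F → ∀ t, good n S t → tlo ≤ t ∧ t ≤ c₀)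
    {alo : ℝ} (halo0 : 0 ≤ alo)
    (halo : ∀ z S₀ τ S F, HopPremiseWith P Bcl shiftSetFlat ε₀ i₀ (mirrorTable ε ε) X₀ w r c₀ ζ
      ustar n z S₀ τ S F → ∀ t, good n S t → alo ≤ clampedRatio P i₀ ε₀ θ₀ t S)
    {Aeff A A₀ A₁ M M₁ M₂ rI RBAR BBAR RHO2 rs I₁ I₂ PUMP μN μB VbarN VbarB EW RT V₀N V₀B EN : ℝ}
    (hAeff : 0 < Aeff) (hM0 : 0 ≤ M)
    (hM : ∀ z, InTubeWith P Bcl i₀ X₀ w r ζ ustar n z →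
      ∀ s ∈ Icc 0 c₀, ∀ i, ∀ m ∈ Finset.Icc (-(P.D : ℤ)) (1 - (P.K : ℤ)), |W z i m s| ≤ M)
    (hM₁ : ∀ z, InTubeWith P Bcl i₀ X₀ w r ζ ustar n z → ∀ s ∈ Icc 0 c₀, |W z 1 (-(P.K : ℤ)) s| ≤ M₁)
    (hM₂0 : 0 ≤ M₂)
    (hM₂ : ∀ z, InTubeWith P Bcl i₀ X₀ w r ζ ustar n z → ∀ s ∈ Icc 0 c₀, |W z 0 (2 - (P.K : ℤ)) s| ≤ M₂)
    (hEW : ∀ z, InTubeWith P Bcl i₀ X₀ w r ζ ustar n z →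
      coMovingEnergyOn (Finset.Icc (1 - (P.D : ℤ)) (-(P.K : ℤ))) P.θV (-(P.K : ℝ))
        (fun i k _ => anchorScale P i₀ z * ustar i k - W₀ z i k) 0 ≤ EW)
    -- section datum at the interface shell and the deeper core input (the only in-hop core data)
    (hsec : ∀ z S₀ τ S F, HopPremiseWith P Bcl shiftSetFlat ε₀ i₀ (mirrorTable ε ε) X₀ w r c₀ ζ
      ustar n z S₀ τ S F → ∀ i, |(S - W z) i (1 - (P.K : ℤ)) 0| ≤ rs)
    (hρ0 : 0 ≤ RHO2)
    (hcore2 : ∀ z S₀ τ S F, HopPremiseWith P Bcl shiftSetFlat ε₀ i₀ (mirrorTable ε ε) X₀ w r c₀ ζ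
      ustar n z S₀ τ S F → ∀ t, good n S t → ∀ s ∈ Icc 0 t, |(S - W z) 0 (2 - (P.K : ℤ)) s| ≤ RHO2)
    -- interface levels (L-61a/L-61b) and link facts
    (hRB0 : 0 ≤ RBAR) (hBB0 : 0 ≤ BBAR) (hRr : RBAR ≤ rI) (hBr : BBAR ≤ rI) (hVN0 : 0 ≤ VbarN)
    (hI₁0 : 0 ≤ I₁) (hI₂0 : 0 ≤ I₂)
    (hI₁ : 2 * (Real.exp (P.θV / 2) - 1) ≤ I₁ * P.θV) (hI₂ : Real.exp P.θV - 1 ≤ I₂ * P.θV)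
    (hPUMPdef : PUMP = 1 * c₀ * ((2 + ε) * M * I₁ * Real.sqrt (2 * VbarN) + 2 * I₂ * VbarN))
    (hlevC : rs + PUMP + 1 * c₀ * ((ε * (M + I₁ * Real.sqrt (2 * VbarN)) + ε * M + ε * BBAR) * RBAR
      + (2 + ε) * M * BBAR + BBAR ^ 2) < RBAR)
    (hlevV : rs + 1 * c₀ * ((M + M₂ + RBAR + RHO2) * BBAR + (1 + 2 * ε) * M * RBAR + ε * RBAR ^ 2
      + (M + 2 * ε * M₂) * RHO2 + ε * RHO2 ^ 2) < BBAR)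
    -- the template landing residual (reference data)
    (hRT : ∀ z S₀ τ S F, HopPremiseWith P Bcl shiftSetFlat ε₀ i₀ (mirrorTable ε ε) X₀ w r c₀ ζ
      ustar n z S₀ τ S F → ∀ t, good n S t →
        ∑ k ∈ Finset.Icc (-(P.D : ℤ)) (-(P.K : ℤ) - 1), Real.exp (P.θV * ((k : ℝ) + P.K)) *
          ∑ i : Fin 2, (W z i (1 + k) t - |S i₀ 1 t| / P.Astar * ustar i k) ^ 2 / 2 ≤ RT)
    -- near/behind schedule (window forms)
    (hAdef : A = Real.sqrt (2 * VbarB) * Real.exp (θ' / 2) * Real.exp (θ' * ((P.D : ℝ) - P.K) / 2) + M)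
    (hA₀def : A₀ = M + rI) (hA₁def : A₁ = M₁ + Real.sqrt (2 * VbarN) * Real.exp (P.θV / 2))
    (hrA : rI ≤ A) (hA₀le : A₀ ≤ Aeff)
    (hV₀Ndef : V₀N = (Real.sqrt (P.v n + (P.δ n / ωK) ^ 2) + Real.sqrt P.D * r + Real.sqrt EW) ^ 2)
    (hV₀Bdef : V₀B = (Real.sqrt (Wb n + (MuK + P.δ n / ωK) ^ 2) + r / Real.sqrt (1 - Real.exp (-θ'))) ^ 2)
    (hENdef : EN = Real.exp (P.θV * ((1 : ℝ) - P.D + P.K)) * ((1 + ε) * 1 * A ^ 2 * (A + M))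
      + 1 * rI * (2 * VbarN + ε * rI * Real.sqrt (2 * VbarN) + (1 + ε) * M * rI))
    (hμN : 0 < μN)
    (hμNle : μN ≤ (1 / c₀) * P.θV - 2 * (1 + ε) * 1 * (A * Real.sinh (P.θV / 2) + M * (3 + Real.exp P.θV)))
    (hμB : 0 < μB) (hμBle : μB ≤ (1 / c₀) * θ' - 2 * (1 + ε) * Aeff * Real.sinh (θ' / 2))
    (hlevN : V₀N + EN * c₀ < VbarN) (hlevB : V₀B + A₁ * A₀ * (A₁ + ε * A₀) * c₀ < VbarB)
    (hclose : Real.sqrt (2 * VbarB) * Real.exp (θ' / 2) ≤ Aeff)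
    (hbudgetN : ∀ t ∈ Icc tlo c₀, (Real.sqrt (Real.exp (-μN * t) * V₀N + EN * (1 - Real.exp (-μN * t)) / μN)
      + Real.sqrt RT) ^ 2 ≤ alo ^ 2 * P.v (n + 1))
    (hbudgetB : ∀ t ∈ Icc tlo c₀, Real.exp (-μB * t) * V₀B + A₁ * A₀ * (A₁ + ε * A₀) * (1 - Real.exp (-μB * t)) / μB
      ≤ alo ^ 2 * Wb (n + 1)) :
    ∀ z S₀ τ S F, HopPremiseWith P Bcl shiftSetFlat ε₀ i₀ (mirrorTable ε ε) X₀ w r c₀ ζ ustar n z S₀ τ S F →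
      ∀ t, good n S t →
        NearClause P i₀ ustar (n + 1) (recentre S t (clampedRatio P i₀ ε₀ θ₀ t S)) ∧
        behindR54 P θ' Wb (n + 1) (recentre S t (clampedRatio P i₀ ε₀ θ₀ t S)) := by
  have hε₀' : (-1 : ℝ) < ε₀ := by linarith
  have hrI0 : 0 ≤ rI := hRB0.trans hRr
  have hA0 : 0 ≤ A := hrI0.trans hrA
  have hEN0 : 0 ≤ EN := by rw [hENdef]; positivity
  have hwin' : ∀ z S₀ τ S F, HopPremiseWith P Bcl shiftSetFlat ε₀ i₀ (mirrorTable ε ε) X₀ w r c₀ ζ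
      ustar n z S₀ τ S F → ∀ t, good n S t → 0 < t ∧ t ≤ c₀ := fun z S₀ τ S F h t ht =>
    ⟨htlo.trans_le (hwin z S₀ τ S F h t ht).1, (hwin z S₀ τ S F h t ht).2⟩
  -- the interface levels at good times (the loop of record)
  have hlev := interfaceLevels_of_schedule_slot P hBcl hWflow hcW hε hε₀ hn hK hDK hθV hθ hθ5 hw1 hr0 hAstar hωK hωKle
    hMuK hWbn hwin' hAeff hM0 hM hM₁ hM₂0 hM₂ hEW hsec hρ0 hcore2 hRB0 hBB0 hRr hBr hVN0 hI₁0 hI₂0 hI₁ hI₂ hPUMPdef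
    hlevC hlevV hAdef hA₀def hA₁def hrA hA₀le hV₀Ndef hV₀Bdef hENdef hμN hμNle hμB hμBle hlevN hlevB hclose
  -- the two landing clauses at every good time of every premise
  have key : ∀ z S₀ τ S F, HopPremiseWith P Bcl shiftSetFlat ε₀ i₀ (mirrorTable ε ε) X₀ w r c₀ ζ
      ustar n z S₀ τ S F → ∀ t, good n S t →
        NearClause P i₀ ustar (n + 1) (recentre S t (clampedRatio P i₀ ε₀ θ₀ t S)) ∧
        R54.BehindEnergyClause P.K θ' (Wb (n + 1)) (recentre S t (clampedRatio P i₀ ε₀ θ₀ t S)) := by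
    intro z S₀ τf S F hprem t hgood
    obtain ⟨htlo_t, htc₀⟩ := hwin z S₀ τf S F hprem t hgood
    have htpos : 0 < t := htlo.trans_le htlo_t
    -- the interface level `rI` on `[0, t]` (both species)
    have hcore_t : ∀ s ∈ Icc 0 t, ∀ i, |(S - W z) i (1 - (P.K : ℤ)) s| ≤ rI := by
      intro s hs i
      obtain ⟨h0, h1⟩ := hlev z S₀ τf S F hprem t hgood s hs
      fin_cases i
      · exact h0.trans hRr
      · exact h1.trans hBr
    have hRT_t := hRT z S₀ τf S F hprem t hgood
    have halo_t := halo z S₀ τf S F hprem t hgood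
    obtain ⟨hz, hkick, hc₀τ, hflow⟩ := hprem
    -- the clauses of `H(n)` (tube phase)
    have hzW : InTubeWith P Bcl i₀ X₀ w r ζ ustar n z := hz
    have h0 : n ≠ 0 := by omega
    have h1 : ¬ n ≤ P.N₀ := by omega
    simp only [InTubeWith, h0, if_false, h1] at hz
    obtain ⟨hanch, hcoreCl, hnearCl, hbeh', -⟩ := hz
    have hbeh := hBcl n z hbeh'
    have hWz := hWflow z hzW
    -- restrict both flows to `[0, t]`
    have hS' := pseudoFlowOnShift_mono hflow htpos (htc₀.trans hc₀τ)
    have hW' := pseudoFlowOnShift_mono hWz htpos (htc₀.trans hcW)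
    -- the kick, everywhere (weights `≥ 1`)
    have hkick' : ∀ i k, |S₀ i k - z i k| ≤ r := by
      intro i k
      calc |S₀ i k - z i k| = 1 * |S₀ i k - z i k| := (one_mul _).symm
        _ ≤ w k * |S₀ i k - z i k| := mul_le_mul_of_nonneg_right (hw1 k) (abs_nonneg _)
        _ ≤ r := hkick i k
    -- the ratio of the choice rule
    have ha : 0 < clampedRatio P i₀ ε₀ θ₀ t S := clampedRatio_pos P i₀ hε₀' θ₀ t S
    have hfa2 : alo ^ 2 ≤ clampedRatio P i₀ ε₀ θ₀ t S ^ 2 := pow_le_pow_left₀ halo0 halo_t 2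
    -- the STARTS from `H(n)`
    have hstartN : coMovingEnergyOn (Finset.Icc (1 - (P.D : ℤ)) (-(P.K : ℤ))) P.θV (-(P.K : ℝ)) (S - W z) 0 ≤ V₀N := by
      have h := sqrt_initial_coMovingEnergyOn_le_additive P hflow.init_S hWz.init_S hθV.le hDK hnearCl hcoreCl hωK
        hωKle (fun i k _ => hkick' i k) hr0 (hEW z hzW)
      have hnn : 0 ≤ coMovingEnergyOn (Finset.Icc (1 - (P.D : ℤ)) (-(P.K : ℤ))) P.θV (-(P.K : ℝ)) (S - W z) 0 :=
        coMovingEnergyOn_nonneg _ _ _ _ _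
      rw [hV₀Ndef]
      calc coMovingEnergyOn (Finset.Icc (1 - (P.D : ℤ)) (-(P.K : ℤ))) P.θV (-(P.K : ℝ)) (S - W z) 0
          = Real.sqrt (coMovingEnergyOn (Finset.Icc (1 - (P.D : ℤ)) (-(P.K : ℤ))) P.θV (-(P.K : ℝ)) (S - W z) 0) ^ 2 :=
            (Real.sq_sqrt hnn).symm
        _ ≤ _ := pow_le_pow_left₀ (Real.sqrt_nonneg _) h 2
    have haK : ∀ i, |z i (-(P.K : ℤ))| ≤ MuK + P.δ n / ωK := fun i =>
      abs_windowBottom_le_of_clauses P hAstar hanch hcoreCl hωK hωKle hMuK i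
    have hstartB : ∀ L : ℕ, coMovingEnergyOn (Finset.Icc (1 - (P.K : ℤ) - L) (-(P.K : ℤ))) θ' (-(P.K : ℝ)) S 0
        ≤ V₀B := by
      intro L
      rw [hV₀Bdef]
      exact R54.initial_blockEnergy_le_additive hflow.init_S hθ hbeh.1 hWbn haK
        (fun i k hk => hkick' i k) hr0
    -- rates and levels at this `t ≤ c₀`
    have h1t : 1 / c₀ ≤ 1 / t := one_div_le_one_div_of_le htpos htc₀
    have hμNle' : μN ≤ (1 / t) * P.θV - 2 * (1 + ε) * 1 * (A * Real.sinh (P.θV / 2) + M * (3 + Real.exp P.θV)) := by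
      have h2 := mul_le_mul_of_nonneg_right h1t hθV.le
      linarith only [h2, hμNle]
    have hμBle' : μB ≤ (1 / t) * θ' - 2 * (1 + ε) * Aeff * Real.sinh (θ' / 2) := by
      have h2 := mul_le_mul_of_nonneg_right h1t hθ.le
      linarith only [h2, hμBle]
    have hlevN' : V₀N + EN * t < VbarN := by
      have h2 := mul_le_mul_of_nonneg_left htc₀ hEN0
      linarith only [h2, hlevN]
    have hA₁0 : 0 ≤ A₁ := by
      rw [hA₁def]
      have hM₁0 : 0 ≤ M₁ := (abs_nonneg _).trans (hM₁ z hzW 0 ⟨le_rfl, htpos.le.trans htc₀⟩)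
      exact add_nonneg hM₁0 (mul_nonneg (Real.sqrt_nonneg _) (Real.exp_pos _).le)
    have hA₀0 : 0 ≤ A₀ := by rw [hA₀def]; exact add_nonneg hM0 hrI0
    have hEtop0 : 0 ≤ A₁ * A₀ * (A₁ + ε * A₀) :=
      mul_nonneg (mul_nonneg hA₁0 hA₀0) (add_nonneg hA₁0 (mul_nonneg hε hA₀0))
    have hlevB' : V₀B + A₁ * A₀ * (A₁ + ε * A₀) * t < VbarB := by
      have h2 := mul_le_mul_of_nonneg_left htc₀ hEtop0
      linarith only [h2, hlevB]
    have hστ : (1 / t) * t = 1 := by rw [one_div, inv_mul_cancel₀ (ne_of_gt htpos)]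
    -- budgets at the clamped ratio
    have hbN := hbudgetN t ⟨htlo_t, htc₀⟩
    have hbB := hbudgetB t ⟨htlo_t, htc₀⟩
    have hbN' : (Real.sqrt (Real.exp (-μN * t) * V₀N + EN * (1 - Real.exp (-μN * t)) / μN) + Real.sqrt RT) ^ 2
        ≤ clampedRatio P i₀ ε₀ θ₀ t S ^ 2 * P.v (n + 1) :=
      hbN.trans (mul_le_mul_of_nonneg_right hfa2 hvn1)
    have hbB' : Real.exp (-μB * t) * V₀B + A₁ * A₀ * (A₁ + ε * A₀) * (1 - Real.exp (-μB * t)) / μB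
        ≤ clampedRatio P i₀ ε₀ θ₀ t S ^ 2 * Wb (n + 1) :=
      hbB.trans (mul_le_mul_of_nonneg_right hfa2 hWbn1)
    -- the joint hop with the level-fed top input
    rw [hENdef] at hbN' hlevN'
    exact R54.near_behind_hop_of_schedule_iface P hW' hS' hε hε₀ hDK hθV.le hθ.le hθ5 hAeff htpos le_rfl hστ ha hM0
      (fun s hs => hM z hzW s ⟨hs.1, hs.2.trans htc₀⟩) (fun s hs => hM₁ z hzW s ⟨hs.1, hs.2.trans htc₀⟩) hcore_t hrI0 hVN0
      hAdef hA₀def hA₁def hrA hA₀le hstartN hstartB hμN hμNle' hμB hμBle' hlevN' hlevB' hclose hRT_t hbN' hbB'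
  intro z S₀ τ S F h t ht
  refine ⟨(key z S₀ τ S F h t ht).1, (key z S₀ τ S F h t ht).2, ?_⟩
  -- (B2∃): the cap, for free from the format clause (4.5)
  obtain ⟨h0, hc⟩ := hwin' z S₀ τ S F h t ht
  obtain ⟨-, -, hc₀τ, hflow⟩ := h
  exact R54.exists_behindCap_recentre hflow hε₀'.le ⟨h0.le, hc.trans hc₀τ⟩ (clampedRatio_pos P i₀ hε₀' θ₀ t S) P.K


end Slot

end Summit.NavierStokesRegularity.NavierStokesRegularity.Theorems.HopTube

end
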